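import Summits.KontsevichZagierPeriods.KontsevichZagierPeriods.Theorems.RootDecompWalshStrataBall4Descent
import Summits.KontsevichZagierPeriods.KontsevichZagierPeriods.Theorems.RootDecompWalshStrataBall4Disc
import Literature.NumberTheory.Transcendental.KZProductIdeal

/-!
# The 4-ball specimen, addendum B: `[B⁴-orthant, 2] ≡ [quarter disc] ⊗ [quarter disc]` inside the rules

Route `RootDecompWalshStrata` (cell decomp-kz, lens 4, gen 11), support toward `QuadricSignKernel`
(item stmt-KontsevichZagierPeriods-25393), slice `d = 4` — the DECOMPOSABLE corner of the weight-2 wall.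
With the product structure of `KZ.FormalRep` (`KZ.of_mul_of`; `KZ.relations` is a two-sided ideal,
`KZ.mul_sub_mul_mem_relations`), addendum A (`[Q, 1] ≡ arcRep 1 = [(0,1), 1/(2((1 − t)² + t²))]`) and the
gen-11 descent `[B⁴-orthant cell, q] ≡ R₂ = [(0,1)², q/(8((1−t₀)²+t₀²)((1−t₁)²+t₁²))]`
(`of_cell_sub_of_sqRep_mem_relations`), both sides land on the same rational 2-cell:
`KZ.of (cellRep ball4Poly 2) − KZ.of ((cellRep discPoly 1).prod (cellRep discPoly 1)) ∈ KZ.relations`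
(`π²/16 = (π/4)²` realised by the three rules: the ball's `π²` is a PRODUCT of two Baker-sector classes).
0 sorry.  [KontsevichZagier2001 §1.2 rules (1)–(3), §4.1]
-/

noncomputable section
/-- `(1 − v)² + v² > 0`. [folklore] -/
private theorem gq_pos (v : ℝ) : 0 < (1 - v) ^ 2 + v ^ 2 := by nlinarith [sq_nonneg (1 - 2 * v)]

open Literature.NumberTheory.Transcendental
open MeasureTheory Set
open MvPolynomial (aeval X C)
open Literature.ModelTheory.ExponentialFields (IsSemialgebraic isSemialgebraic_setOf_eval_pos
  isSemialgebraic_setOf_eval_lt continuous_aeval_real)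
open Summit.KontsevichZagierPeriods.RootDecompWalshStrata.WalshSpanProof (isSemialgebraic_cubeSet
  isBounded_cubeSet cellRep cellRep_domain cellRep_integrand)
open Summit.KontsevichZagierPeriods.RootDecompWalshStrata.ConeSpecimen (discPoly aeval_discPoly)

namespace Summit.KontsevichZagierPeriods.RootDecompWalshStrata.Ball4

/-! #### The product: `arcRep 1 ⊗ arcRep 1` is `R₂` with weight `2` -/

/-- The product representation `arcRep 1 ⊗ arcRep 1` has the unit square as domain. [KZ2001 §4.1] -/
theorem prod_arcRep_domain : ((arcRep 1).prod (arcRep 1)).domain = sqSet := by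
  rw [KZ.IntegralRep.prod_domain]
  ext z
  simp only [KZ.IntegralRep.mem_prodDomain, arcRep_domain, ivSet, sqSet, mem_setOf_eq]
  constructor
  · rintro ⟨h0, h1⟩ j
    fin_cases j
    · exact h0 0
    · exact h1 0
  · intro h
    refine ⟨fun i => ?_, fun j => ?_⟩
    · fin_cases i
      exact h 0
    · fin_cases j
      exact h 1

/-- **`arcRep 1 ⊗ arcRep 1 − sqRep 2 ∈ KZ.relations`** (same domain, integrands agree:
`1/(2G(t₀)) · 1/(2G(t₁)) = 2/(8G(t₀)G(t₁))`). [KontsevichZagier2001 §4.1; rule (1)] -/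
theorem of_prod_arcRep_sub_of_sqRep_mem_relations :
    KZ.of ((arcRep 1).prod (arcRep 1)) - KZ.of (sqRep 2) ∈ KZ.relations := by
  refine KZ.of_sub_of_mem_relations_of_eqOn ?_ fun z _ => ?_
  · rw [sqRep_domain, prod_arcRep_domain]
  · rw [KZ.IntegralRep.prod_integrand_eq, sqRep_integrand]
    simp only [KZ.IntegralRep.prodFun, arcRep_integrand]
    have e0 : z (Fin.castAdd 1 (0 : Fin 1)) = z 0 := rfl
    have e1 : z (Fin.natAdd 1 (0 : Fin 1)) = z 1 := rfl
    rw [e0, e1]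
    have hG0 := (gq_pos (z 0)).ne'
    have hG1 := (gq_pos (z 1)).ne'
    push_cast
    field_simp
    ring

/-! #### Assembly: `[B⁴-orthant, 2] ≡ [Q, 1] ⊗ [Q, 1]` -/

/-- **The decomposable corner of the weight-2 wall, inside the rules.**  Twice the orthant of the unit
4-ball (constant weight `2`, value `π²/16`) is equivalent modulo `KZ.relations` to the PRODUCT
representation of two quarter discs (value `(π/4)²`): both sides descend, by the three KZ rules and
the product structure (`KZ.of_mul_of`, `KZ.mul_sub_mul_mem_relations`), to
`R₂ = [(0,1)², 1/(4((1−t₀)²+t₀²)((1−t₁)²+t₁²))]`.  No transcendence input.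
[KontsevichZagier2001 §1.2, §4.1; this node] -/
theorem of_cell_two_sub_of_disc_prod_disc_mem_relations :
    KZ.of (cellRep ball4Poly 2) - KZ.of ((cellRep discPoly 1).prod (cellRep discPoly 1)) ∈
      KZ.relations := by
  have h1 := of_cell_sub_of_sqRep_mem_relations 2
  have h2 := of_prod_arcRep_sub_of_sqRep_mem_relations
  have hd := of_disc_sub_of_arcRep_mem_relations 1
  have h3 : KZ.of ((cellRep discPoly 1).prod (cellRep discPoly 1)) -
      KZ.of ((arcRep 1).prod (arcRep 1)) ∈ KZ.relations := by
    have h := KZ.mul_sub_mul_mem_relations hd hd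
    rwa [KZ.of_mul_of, KZ.of_mul_of] at h
  have : KZ.of (cellRep ball4Poly 2) - KZ.of ((cellRep discPoly 1).prod (cellRep discPoly 1)) =
      (KZ.of (cellRep ball4Poly 2) - KZ.of (sqRep 2)) -
        (KZ.of ((arcRep 1).prod (arcRep 1)) - KZ.of (sqRep 2)) -
        (KZ.of ((cellRep discPoly 1).prod (cellRep discPoly 1)) -
          KZ.of ((arcRep 1).prod (arcRep 1))) := by abel
  rw [this]
  exact sub_mem (sub_mem h1 h2) h3

/-- The same statement in the ring `KZ.FormalRep`: `[B⁴-orthant, 2] − [Q, 1]·[Q, 1] ∈ KZ.relations`.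
[KontsevichZagier2001 §4.1; this node] -/
theorem of_cell_two_sub_of_disc_mul_disc_mem_relations :
    KZ.of (cellRep ball4Poly 2) - KZ.of (cellRep discPoly 1) * KZ.of (cellRep discPoly 1) ∈
      KZ.relations := by
  rw [KZ.of_mul_of]
  exact of_cell_two_sub_of_disc_prod_disc_mem_relations

/-- **Equivalence form:** `[B⁴-orthant, 2] ∼ [Q, 1] ⊗ [Q, 1]`. [KontsevichZagier2001 §1.2, §4.1; this node] -/
theorem equivalent_cell_two_disc_prod_disc :
    KZ.Equivalent (cellRep ball4Poly 2) ((cellRep discPoly 1).prod (cellRep discPoly 1)) :=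
  of_cell_two_sub_of_disc_prod_disc_mem_relations

end Summit.KontsevichZagierPeriods.RootDecompWalshStrata.Ball4

end
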